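import Summits.ValiantsHypothesis.ValiantsHypothesis.Theorems.GeneratorObstructionsPerGenDegreeSuperQPBalancedMonomialRays
import Literature.Computability.AlgebraicComplexity.BI17ChowMinimalDegreeValues
import Literature.Computability.AlgebraicComplexity.BI17ChowPowerSumPolystableProofs
import Literature.Computability.AlgebraicComplexity.BI17NonNormalOrbitClosuresProofs

/-!
# Route GeneratorObstructions — K1 `PerGenDegreeSuperQP` (stmt-ValiantsHypothesis-11654),
# line `per-side-atoms`: the FIRST atom on the Chow ray `j = m` of `S(per_m)` — degree between
# `m` and `e(X₁⋯X_m)`, hence exactly `(m^m)^*` in degree `m` under Alon–Tarsi (all even `m ≤ 24`)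

Fourteenth support file of the line. The ray criterion (`…RayCriterion`) says that the first
occurrence degree on the rectangular ray `j` of `S(per_m)` is the least degree of an
`SL_j`-invariant detecting a `j`-variable degeneration of `per_m`. On the CHOW RAY `j = m` the
Chow form `y₁⋯y_m` is such a degeneration (`chow_mem_orbitClosure_per`: the row collapse
`x_{ik} ↦ x_{kk}` gives `m!·x₁₁⋯x_mm`), so:

* `le_of_per_rectangle_occurs` — on ANY ray `j`, an occurring `(k^j)^*` has `k ≥ m` (GIP 2017
  Prop. 13, `λ₁ ≥ m`): the first degree on ray `j` is at least `j`;
* `per_chowRay_occurs_minimalDegree` — `(e^m)^*` occurs for `e = e(y₁⋯y_m)`, BI 2017's minimal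
  degree of the Chow form (Def. 3.3; `≥ m`, `= m` iff `m` even and the Alon–Tarsi conjecture
  `AT(m)` holds, Prop. 3.25; `= m+1` for odd `m` iff `AT(m+1)`, Rem. 3.26): the first degree on
  the Chow ray lies in `[m, e(y₁⋯y_m)]`;
* `per_chow_atom_of_alonTarsi`, `per_chow_atom_of_even_le_24` — for even `m ≥ 2` with `AT(m)`
  (a THEOREM of the tree for all even `m ≤ 24`: Drisko, Glynn) the first atom on the Chow ray of
  `S(per_m)` is exactly `(m^m)^*`, in degree `m` — the permanent's analogue of Kumar's
  "`AT(n)` ⇒ `(n^n)`-type occurrence in `ℂ[Det_n]`".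

Calibration value: these atoms are EARLY (degree `m`); together with `…AtomCertificates`
(degree-1 atom), `…RectangularAtom`/`…MinimalDegree` (top ray, degree `e(per_m) ≥ m²`) they are
the only rays of `S(per_m)` whose first degree is pinned down. Honest framing: `stub_atomLate`
(`c ≥ 2`), K1 and `GenFlipThesis` remain OPEN; nothing here bears on VP versus VNP.
References: [BurgisserIkenmeyer2017] Def. 3.3, Prop. 3.25, Rem. 3.26; [Kumar2015] (Alon–Tarsi and
the Chow variety); [GesmundoIkenmeyerPanova2017] Prop. 13.
-/

set_option linter.dupNamespace false

noncomputable section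

namespace Summit.ValiantsHypothesis.ValiantsHypothesis.Theorems.GeneratorObstructions.PerGenDegreeSuperQP

open MvPolynomial
open Literature.NumberTheory.DiophantineGeometry Literature.Computability.AlgebraicComplexity
  Literature.Computability.Complexity

variable {m : ℕ}

/-- **First parts are at least `m` on every ray**: if the rectangular weight `(k^j)^*`
(`1 ≤ j ≤ m²`, `k ≥ 1`) occurs in `ℂ[Δ_m[per_m]]` then `m ≤ k` (GIP 2017 Prop. 13 via the tree's
`le_neg_apply_top_of_occurs`); so the first-occurrence degree `jk/m` on ray `j` is at least `j`.
[cite: GesmundoIkenmeyerPanova2017, Prop. 13] -/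
theorem le_of_per_rectangle_occurs (hm : 1 ≤ m) {j k : ℕ} (hj : 0 < j) (hjm : j ≤ m * m) (hk : 0 < k)
    (hocc : highestWeightSpace (orbitCoordRep (MvPolynomial.rename toLex (perPoly (Fin m) ℂ)) m)
      (partitionWeightLex m (Nat.Partition.rectangle j k)) ≠ ⊥) :
    m ≤ k := by
  haveI : NeZero m := ⟨by omega⟩
  haveI : NeZero (m * m) := ⟨Nat.mul_ne_zero (by omega) (by omega)⟩
  have h := le_neg_apply_top_of_occurs _ (show m ≠ 0 by omega) (perFormLex_isHomogeneous m) hocc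
    (partitionWeightLex_rectangle_ne_zero hj hjm hk)
  rw [← revMatIdx_zero, partitionWeightLex_rectangle_apply, Equiv.symm_apply_apply] at h
  simp only [Fin.val_zero, hj, if_true, neg_neg] at h
  exact_mod_cast h

/-- **Row collapse of the permanent onto the diagonal Chow form**: renaming `x_{ik} ↦ x_{kk}` turns
`per_m` into `m! · x₁₁ x₂₂ ⋯ x_mm`. [folklore] -/
theorem rename_diagCollapse_perFormLex (m : ℕ) :
    MvPolynomial.rename (fun x : MatIdx m => (toLex ((ofLex x).2, (ofLex x).2) : MatIdx m))
        (MvPolynomial.rename (toLex : Fin m × Fin m → MatIdx m) (perPoly (Fin m) ℂ)) =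
      (m.factorial : ℂ) • ∏ s : Fin m, X (toLex (s, s) : MatIdx m) := by
  rw [perFormLex_eq_sum, map_sum]
  trans ∑ _σ : Equiv.Perm (Fin m), ∏ s : Fin m, (X (toLex (s, s) : MatIdx m) : MvPolynomial (MatIdx m) ℂ)
  · refine Finset.sum_congr rfl fun σ _ => ?_
    rw [map_prod]
    simp only [rename_X, ofLex_toLex]
  · rw [Finset.sum_const, Finset.card_univ, Fintype.card_perm, Fintype.card_fin,
      ← Nat.cast_smul_eq_nsmul ℂ]

/-- **The Chow form is an `m`-variable degeneration of the permanent**: `y₁⋯y_m`, placed on the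
diagonal matrix variables, lies in `Δ(per_m)` (`m ≥ 1`). [cite: MulmuleySohoni2001, §4] -/
theorem chow_mem_orbitClosure_per (hm : 1 ≤ m) :
    MvPolynomial.rename (fun s : Fin m => (toLex (s, s) : MatIdx m)) (∏ s : Fin m, X s : MvPolynomial (Fin m) ℂ) ∈
      orbitClosure (MvPolynomial.rename (toLex : Fin m × Fin m → MatIdx m) (perPoly (Fin m) ℂ)) := by
  haveI : Infinite ℂ := CharZero.infinite ℂ
  have hmem := rename_mem_orbitClosure_of_selfMap
    (fun x : MatIdx m => (toLex ((ofLex x).2, (ofLex x).2) : MatIdx m))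
    (MvPolynomial.rename (toLex : Fin m × Fin m → MatIdx m) (perPoly (Fin m) ℂ))
  rw [rename_diagCollapse_perFormLex] at hmem
  have h := smul_mem_orbitClosure (perFormLex_isHomogeneous m) (by omega) hmem ((m.factorial : ℂ))⁻¹
  rw [smul_smul, inv_mul_cancel₀ (by exact_mod_cast (Nat.factorial_pos _).ne'), one_smul] at h
  simpa [map_prod, rename_X] using h

/-- **The Chow ray is hit at the minimal degree of the Chow form**: for `m ≥ 1`, with
`e = e(y₁⋯y_m)` (BI 2017 Def. 3.3, `minimalDegree`), the weight `(e^m)^*` occurs in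
`ℂ[Δ_m[per_m]]` and `e ≥ 1` — the first-occurrence degree on the ray `j = m` is at most
`e(y₁⋯y_m)`. [cite: BurgisserIkenmeyer2017, Def. 3.3] -/
theorem per_chowRay_occurs_minimalDegree (hm : 1 ≤ m) :
    0 < minimalDegree m (∏ s : Fin m, X s : MvPolynomial (Fin m) ℂ) ∧
      highestWeightSpace (orbitCoordRep (MvPolynomial.rename toLex (perPoly (Fin m) ℂ)) m)
        (partitionWeightLex m (Nat.Partition.rectangle m
          (minimalDegree m (∏ s : Fin m, X s : MvPolynomial (Fin m) ℂ)))) ≠ ⊥ := by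
  obtain ⟨hE, hpos⟩ := minimalDegree_pos_mem hm (isHomogeneous_prod_X_fin m) (prod_X_fin_ne_zero m)
    (isPolystable_prod_X m)
  refine ⟨hpos, ?_⟩
  have hκ : Function.Injective (fun s : Fin m => (toLex (s, s) : MatIdx m)) := by
    intro s s' h
    have := congrArg (fun x : MatIdx m => (ofLex x).1) h
    simpa using this
  obtain ⟨-, hocc⟩ := hasHighestWeight_rectangle_of_projection (matIdxEquiv m) (show m ≠ 0 by omega)
    (perFormLex_isHomogeneous m) hm _ hκ (isHomogeneous_prod_X_fin m) (chow_mem_orbitClosure_per hm) hE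
  rw [Nat.mul_div_cancel_left _ (by omega : 0 < m)] at hocc
  exact hocc

/-- **The first atom on the Chow ray under Alon–Tarsi.** For even `m ≥ 2` satisfying the
Alon–Tarsi conjecture `AT(m)`, the rectangular weight `(m^m)^*` OCCURS in `ℂ[Δ_m[per_m]]` (in
degree `m`) and is an ATOM of the occurrence monoid — the least weight on the ray `j = m`
(`e(y₁⋯y_m) = m` by BI 2017 Prop. 3.25, and first parts are `≥ m`).
[cite: BurgisserIkenmeyer2017, Prop. 3.25] -/
theorem per_chow_atom_of_alonTarsi (heven : Even m) (hm : 2 ≤ m)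
    (hAT : Literature.Barriers.ValiantsHypothesis.AlonTarsiConjecture m) :
    highestWeightSpace (orbitCoordRep (MvPolynomial.rename toLex (perPoly (Fin m) ℂ)) m)
        (partitionWeightLex m (Nat.Partition.rectangle m m)) ≠ ⊥ ∧
      (∀ k : ℕ, 0 < k → k < m →
        highestWeightSpace (orbitCoordRep (MvPolynomial.rename toLex (perPoly (Fin m) ℂ)) m)
          (partitionWeightLex m (Nat.Partition.rectangle m k)) = ⊥) ∧
      (∀ χ₁ χ₂ : Weight (MatIdx m), χ₁ + χ₂ = partitionWeightLex m (Nat.Partition.rectangle m m) →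
        χ₁ ≠ 0 → χ₂ ≠ 0 →
        highestWeightSpace (orbitCoordRep (MvPolynomial.rename toLex (perPoly (Fin m) ℂ)) m) χ₁ = ⊥ ∨
          highestWeightSpace (orbitCoordRep (MvPolynomial.rename toLex (perPoly (Fin m) ℂ)) m) χ₂ = ⊥) := by
  have hm1 : 1 ≤ m := by omega
  have he : minimalDegree m (∏ s : Fin m, X s : MvPolynomial (Fin m) ℂ) = m :=
    (minimalDegree_prod_X_eq_iff_alonTarsi heven hm).mpr hAT
  have hocc := (per_chowRay_occurs_minimalDegree hm1).2
  rw [he] at hocc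
  have hmin : ∀ k : ℕ, 0 < k → k < m →
      highestWeightSpace (orbitCoordRep (MvPolynomial.rename toLex (perPoly (Fin m) ℂ)) m)
        (partitionWeightLex m (Nat.Partition.rectangle m k)) = ⊥ := by
    intro k hk hkm
    by_contra hne
    have := le_of_per_rectangle_occurs hm1 (by omega) (Nat.le_mul_of_pos_right m hm1) hk hne
    omega
  refine ⟨hocc, hmin, ?_⟩
  -- the least weight on the ray is an atom; it is `(m^m)^*` by `hmin` and `hocc`
  obtain ⟨k₀, hk₀, hocc₀, hmin₀, hatom⟩ := exists_least_rectangle_atom _ _ (by omega : 0 < m)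
    (Nat.le_mul_of_pos_right m hm1) ⟨m, by omega, hocc⟩
  have hk₀m : k₀ = m := by
    rcases lt_trichotomy k₀ m with hlt | heq | hgt
    · exact absurd (hmin k₀ hk₀ hlt) hocc₀
    · exact heq
    · exact absurd (hmin₀ m (by omega) hgt) hocc
  rw [hk₀m] at hatom
  exact hatom

/-- **Unconditionally for even `2 ≤ m ≤ 24`**: `(m^m)^*` occurs in `ℂ[Δ_m[per_m]]` and is the
first atom on the Chow ray (the Alon–Tarsi conjecture is a theorem of the tree for even sizes
`≤ 24`: Drisko `p+1`, Glynn `p-1`). [cite: BurgisserIkenmeyer2017, Prop. 3.25] -/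
theorem per_chow_atom_of_even_le_24 (heven : Even m) (hm : 2 ≤ m) (h24 : m ≤ 24) :
    highestWeightSpace (orbitCoordRep (MvPolynomial.rename toLex (perPoly (Fin m) ℂ)) m)
        (partitionWeightLex m (Nat.Partition.rectangle m m)) ≠ ⊥ ∧
      (∀ k : ℕ, 0 < k → k < m →
        highestWeightSpace (orbitCoordRep (MvPolynomial.rename toLex (perPoly (Fin m) ℂ)) m)
          (partitionWeightLex m (Nat.Partition.rectangle m k)) = ⊥) ∧
      (∀ χ₁ χ₂ : Weight (MatIdx m), χ₁ + χ₂ = partitionWeightLex m (Nat.Partition.rectangle m m) →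
        χ₁ ≠ 0 → χ₂ ≠ 0 →
        highestWeightSpace (orbitCoordRep (MvPolynomial.rename toLex (perPoly (Fin m) ℂ)) m) χ₁ = ⊥ ∨
          highestWeightSpace (orbitCoordRep (MvPolynomial.rename toLex (perPoly (Fin m) ℂ)) m) χ₂ = ⊥) :=
  per_chow_atom_of_alonTarsi heven hm
    (Literature.Barriers.ValiantsHypothesis.alonTarsi_of_even_le_24_holds heven hm h24)

end Summit.ValiantsHypothesis.ValiantsHypothesis.Theorems.GeneratorObstructions.PerGenDegreeSuperQP

end
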